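import Summits.NavierStokesRegularity.NavierStokesRegularity.Theorems.FilamentSkeletonRssCoreLinearInvertibilityOddAttenuationAngular
import Summits.AnomalousDissipation.AnomalousDissipation.Theorems.MarginalStabilityChainStretchedVortexRowsStubCoreInverseIntegrabilityClass

/-!
# Tools D for stub `stub_oddAttenuation` of crux `CoreLinearInvertibility`
# (stmt-NavierStokesRegularity-17973), line `Sketch`: multipliers and the energy estimates

The conjugated local operator `H̃u = Δu + λ x₀∂₀u − (κ|x|² + δx₀²) u + ((1+λ)/2) u − R Ω ∂_θu`
(`Ω = (8π)⁻¹ φ(|x|²/4)`, `∂_θu = Du[x^⊥]`) paired with `u` and with `|x|² u`, for `u ∈ C²` of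
Gaussian decay with two derivatives:

* (E) `∫ (H̃u) u = −∫|∇u|² − ∫ V u² + ½ ∫ u²`, whence `κ ∫|x|²u² ≤ ‖H̃u‖‖u‖ + ½‖u‖²`;
* (W) `∫ (H̃u) |x|²u = −∫|x|²|∇u|² + 2∫u² + ½∫|x|²u² − λ∫x₀²u² − ∫V|x|²u²`, whence
  `∫ |x|²|∇u|² ≤ ‖H̃u‖²/(4κ) + 2‖u‖² + ½∫|x|²u²` (`λ, δ ≥ 0`, `κ > 0`).

Also the multiplier calculus (`x₀`, `|x|²`, `Ω`, products) feeding tools B.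
-/

set_option linter.dupNamespace false

noncomputable section

namespace Summit.NavierStokesRegularity.NavierStokesRegularity.Theorems

open MeasureTheory Filter Topology Set
open Literature.Analysis.FluidPDE
open Summit.AnomalousDissipation.AnomalousDissipation.Theorems.MarginalStabilityChainStretchedVortexRows
open scoped InnerProductSpace Laplacian ContDiff

/-! ### Two absolute-value bookkeeping facts -/

/-- `|a b²| ≤ |a| |b| |b|` (with equality). [folklore] -/
theorem abs_mul_sq_le (a b : ℝ) : |a * b ^ 2| ≤ |a| * |b| * |b| := by
  rw [abs_mul, abs_pow, sq, mul_assoc]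

/-- `|b²| ≤ |1| |b| |b|` (with equality). [folklore] -/
theorem abs_sq_le_one_mul (b : ℝ) : |b ^ 2| ≤ |(1 : ℝ)| * |b| * |b| := by
  rw [abs_pow, sq, abs_one, one_mul]

/-! ### Multipliers: coordinates, `|x|²`, `Ω`, products -/

/-- Coordinates are smooth. [folklore] -/
theorem contDiff_coord (j : Fin 2) {n : WithTop ℕ∞} : ContDiff ℝ n fun y : EuclideanSpace ℝ (Fin 2) => y j :=
  (EuclideanSpace.proj j : EuclideanSpace ℝ (Fin 2) →L[ℝ] ℝ).contDiff

/-- `∂ᵥ xⱼ = vⱼ`. [folklore] -/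
theorem fderiv_coord_apply (j : Fin 2) (x v : EuclideanSpace ℝ (Fin 2)) :
    fderiv ℝ (fun y : EuclideanSpace ℝ (Fin 2) => y j) x v = v j := by
  rw [show (fun y : EuclideanSpace ℝ (Fin 2) => y j) =
      ⇑(EuclideanSpace.proj j : EuclideanSpace ℝ (Fin 2) →L[ℝ] ℝ) from rfl, ContinuousLinearMap.fderiv]
  rfl

/-- `∂ᵥ xⱼ` is polynomially bounded (constant). [folklore] -/
theorem polyBound_fderiv_coord (j : Fin 2) (v : EuclideanSpace ℝ (Fin 2)) :
    ∃ (C : ℝ) (N : ℕ), ∀ x : EuclideanSpace ℝ (Fin 2),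
      |fderiv ℝ (fun y : EuclideanSpace ℝ (Fin 2) => y j) x v| ≤ C * (1 + ‖x‖) ^ N :=
  ⟨|v j|, 0, fun x => by rw [fderiv_coord_apply]; simp⟩

/-- `∂ᵥ|x|² = 2⟪x, v⟫`. [folklore] -/
theorem fderiv_norm_sq_apply' (x v : EuclideanSpace ℝ (Fin 2)) :
    fderiv ℝ (fun y : EuclideanSpace ℝ (Fin 2) => ‖y‖ ^ 2) x v = 2 * ⟪x, v⟫_ℝ := by
  rw [(hasStrictFDerivAt_norm_sq x).hasFDerivAt.fderiv]
  simp only [FunLike.coe_smul, Pi.smul_apply, innerSL_apply_apply, nsmul_eq_mul, Nat.cast_ofNat]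

/-- `|x|²` is polynomially bounded. [folklore] -/
theorem polyBound_norm_sq :
    ∃ (C : ℝ) (N : ℕ), ∀ x : EuclideanSpace ℝ (Fin 2), |‖x‖ ^ 2| ≤ C * (1 + ‖x‖) ^ N :=
  ⟨1, 2, fun x => by rw [abs_of_nonneg (sq_nonneg _), one_mul]; nlinarith [norm_nonneg x]⟩

/-- `∂ᵥ|x|²` is polynomially bounded. [folklore] -/
theorem polyBound_fderiv_norm_sq (v : EuclideanSpace ℝ (Fin 2)) :
    ∃ (C : ℝ) (N : ℕ), ∀ x : EuclideanSpace ℝ (Fin 2),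
      |fderiv ℝ (fun y : EuclideanSpace ℝ (Fin 2) => ‖y‖ ^ 2) x v| ≤ C * (1 + ‖x‖) ^ N :=
  ⟨2 * ‖v‖, 1, fun x => by
    rw [fderiv_norm_sq_apply', abs_mul, abs_two, pow_one]
    nlinarith [abs_real_inner_le_norm x v, norm_nonneg v, norm_nonneg x]⟩

/-- The angular velocity `Ω = (8π)⁻¹ φ(|x|²/4)` of the Gaussian vortex is smooth. [folklore] -/
theorem contDiff_omega {n : WithTop ℕ∞} :
    ContDiff ℝ n fun y : EuclideanSpace ℝ (Fin 2) => (8 * Real.pi)⁻¹ * burgersPhi (‖y‖ ^ 2 / 4) :=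
  contDiff_const.mul (contDiff_burgersPhi.comp ((contDiff_norm_sq ℝ).div_const 4))

/-- `DΩ(x) = (8π)⁻¹ φ′(|x|²/4) · ½⟪x, ·⟫`. [folklore] -/
theorem hasFDerivAt_omega (x : EuclideanSpace ℝ (Fin 2)) :
    HasFDerivAt (fun y : EuclideanSpace ℝ (Fin 2) => (8 * Real.pi)⁻¹ * burgersPhi (‖y‖ ^ 2 / 4))
      ((8 * Real.pi)⁻¹ • (deriv burgersPhi (‖x‖ ^ 2 / 4) • ((1 / 2 : ℝ) • innerSL ℝ x))) x := by
  have hq : HasFDerivAt (fun η : EuclideanSpace ℝ (Fin 2) => ‖η‖ ^ 2 / 4) ((1 / 2 : ℝ) • innerSL ℝ x) x := by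
    have h := (hasStrictFDerivAt_norm_sq x).hasFDerivAt.const_mul (1 / 4 : ℝ)
    have hfun : (fun η : EuclideanSpace ℝ (Fin 2) => ‖η‖ ^ 2 / 4) = fun η => (1 / 4 : ℝ) * ‖η‖ ^ 2 := by
      funext η; ring
    rw [hfun]
    refine h.congr_fderiv ?_
    ext v
    simp [two_smul]
    ring
  have hφd : HasDerivAt burgersPhi (deriv burgersPhi (‖x‖ ^ 2 / 4)) (‖x‖ ^ 2 / 4) :=
    ((contDiff_burgersPhi (n := 1)).differentiable one_ne_zero _).hasDerivAt
  exact (hφd.comp_hasFDerivAt x hq).const_mul ((8 * Real.pi)⁻¹)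

/-- `∂ᵥΩ(x) = (8π)⁻¹ φ′(|x|²/4) ⟪x, v⟫/2`. [folklore] -/
theorem fderiv_omega_apply (x v : EuclideanSpace ℝ (Fin 2)) :
    fderiv ℝ (fun y : EuclideanSpace ℝ (Fin 2) => (8 * Real.pi)⁻¹ * burgersPhi (‖y‖ ^ 2 / 4)) x v =
      (8 * Real.pi)⁻¹ * (deriv burgersPhi (‖x‖ ^ 2 / 4) * (1 / 2 * ⟪x, v⟫_ℝ)) := by
  rw [(hasFDerivAt_omega x).fderiv]
  simp only [FunLike.coe_smul, Pi.smul_apply, innerSL_apply_apply, smul_eq_mul]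

/-- `Ω` is radial: `∂_θΩ = 0`. [folklore] -/
theorem fderiv_omega_perp (x : EuclideanSpace ℝ (Fin 2)) :
    fderiv ℝ (fun y : EuclideanSpace ℝ (Fin 2) => (8 * Real.pi)⁻¹ * burgersPhi (‖y‖ ^ 2 / 4)) x (perp x) = 0 := by
  rw [fderiv_omega_apply, inner_self_perp]; simp

/-- `0 < Ω ≤ (8π)⁻¹ ≤ 1`: `Ω` is polynomially bounded. [folklore] -/
theorem polyBound_omega :
    ∃ (C : ℝ) (N : ℕ), ∀ x : EuclideanSpace ℝ (Fin 2), |(8 * Real.pi)⁻¹ * burgersPhi (‖x‖ ^ 2 / 4)| ≤ C * (1 + ‖x‖) ^ N := by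
  refine ⟨1, 0, fun x => ?_⟩
  have hφ : burgersPhi (‖x‖ ^ 2 / 4) ≤ 1 := burgersPhi_le_one (by positivity)
  have hφ0 : 0 < burgersPhi (‖x‖ ^ 2 / 4) := burgersPhi_pos _
  have hc : (8 * Real.pi)⁻¹ ≤ 1 := inv_le_one_of_one_le₀ (by nlinarith [Real.pi_gt_three])
  have hc0 : 0 < (8 * Real.pi)⁻¹ := by positivity
  rw [abs_of_pos (mul_pos hc0 hφ0), pow_zero, mul_one]
  nlinarith

/-- `∂ᵥΩ` is polynomially bounded (`|φ′| ≤ ½`). [folklore] -/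
theorem polyBound_fderiv_omega (v : EuclideanSpace ℝ (Fin 2)) :
    ∃ (C : ℝ) (N : ℕ), ∀ x : EuclideanSpace ℝ (Fin 2),
      |fderiv ℝ (fun y : EuclideanSpace ℝ (Fin 2) => (8 * Real.pi)⁻¹ * burgersPhi (‖y‖ ^ 2 / 4)) x v| ≤
        C * (1 + ‖x‖) ^ N := by
  refine ⟨‖v‖, 1, fun x => ?_⟩
  rw [fderiv_omega_apply, pow_one]
  have hφ' : |deriv burgersPhi (‖x‖ ^ 2 / 4)| ≤ 1 / 2 := abs_deriv_burgersPhi_le_half _ (by positivity)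
  have hc : (8 * Real.pi)⁻¹ ≤ 1 := inv_le_one_of_one_le₀ (by nlinarith [Real.pi_gt_three])
  have hc0 : 0 < (8 * Real.pi)⁻¹ := by positivity
  have hi : |⟪x, v⟫_ℝ| ≤ ‖x‖ * ‖v‖ := abs_real_inner_le_norm x v
  rw [abs_mul, abs_mul, abs_mul, abs_of_pos hc0, abs_of_pos (by norm_num : (0 : ℝ) < 1 / 2)]
  calc (8 * Real.pi)⁻¹ * (|deriv burgersPhi (‖x‖ ^ 2 / 4)| * (1 / 2 * |⟪x, v⟫_ℝ|))
      ≤ 1 * (1 / 2 * (1 / 2 * (‖x‖ * ‖v‖))) := by gcongr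
    _ ≤ ‖v‖ * (1 + ‖x‖) := by nlinarith [norm_nonneg x, norm_nonneg v]

/-- The derivative of a product of two `C¹` polynomially bounded multipliers with polynomially
bounded derivatives is polynomially bounded. [folklore] -/
theorem polyBound_fderiv_mul_apply {m₁ m₂ : EuclideanSpace ℝ (Fin 2) → ℝ} (h₁ : ContDiff ℝ 1 m₁)
    (h₂ : ContDiff ℝ 1 m₂) (p₁ : ∃ (C : ℝ) (N : ℕ), ∀ x, |m₁ x| ≤ C * (1 + ‖x‖) ^ N)
    (p₂ : ∃ (C : ℝ) (N : ℕ), ∀ x, |m₂ x| ≤ C * (1 + ‖x‖) ^ N) (v : EuclideanSpace ℝ (Fin 2))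
    (d₁ : ∃ (C : ℝ) (N : ℕ), ∀ x, |fderiv ℝ m₁ x v| ≤ C * (1 + ‖x‖) ^ N)
    (d₂ : ∃ (C : ℝ) (N : ℕ), ∀ x, |fderiv ℝ m₂ x v| ≤ C * (1 + ‖x‖) ^ N) :
    ∃ (C : ℝ) (N : ℕ), ∀ x, |fderiv ℝ (fun y => m₁ y * m₂ y) x v| ≤ C * (1 + ‖x‖) ^ N := by
  refine polyBound_of_le_add
    (polyBound_of_le_mul p₁ d₂ (H := fun x => m₁ x * fderiv ℝ m₂ x v) fun x => (abs_mul _ _).le)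
    (polyBound_of_le_mul p₂ d₁ (H := fun x => m₂ x * fderiv ℝ m₁ x v) fun x => (abs_mul _ _).le)
    fun x => ?_
  rw [fderiv_fun_mul (h₁.differentiable one_ne_zero x) (h₂.differentiable one_ne_zero x)]
  simp only [add_apply, FunLike.coe_smul, Pi.smul_apply, smul_eq_mul]
  exact abs_add_le _ _

/-- The product of two `C¹` polynomially bounded multipliers, applied pointwise formula. [folklore] -/
theorem fderiv_mul_apply_of_contDiff {m₁ m₂ : EuclideanSpace ℝ (Fin 2) → ℝ} (h₁ : ContDiff ℝ 1 m₁)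
    (h₂ : ContDiff ℝ 1 m₂) (x v : EuclideanSpace ℝ (Fin 2)) :
    fderiv ℝ (fun y => m₁ y * m₂ y) x v = m₁ x * fderiv ℝ m₂ x v + m₂ x * fderiv ℝ m₁ x v := by
  rw [fderiv_fun_mul (h₁.differentiable one_ne_zero x) (h₂.differentiable one_ne_zero x)]
  simp only [add_apply, FunLike.coe_smul, Pi.smul_apply, smul_eq_mul]


/-! ### The conjugated operator paired with `u` and `|x|²u` -/

section Energy

variable {u : EuclideanSpace ℝ (Fin 2) → ℝ} (hu : ContDiff ℝ 2 u)
  (hB : ∃ (C : ℝ) (N : ℕ), ∀ x, |u x| ≤ C * (1 + ‖x‖) ^ N * Real.exp (-(1 / 8 * ‖x‖ ^ 2)) ∧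
      ‖fderiv ℝ u x‖ ≤ C * (1 + ‖x‖) ^ N * Real.exp (-(1 / 8 * ‖x‖ ^ 2)) ∧
      ‖fderiv ℝ (fderiv ℝ u) x‖ ≤ C * (1 + ‖x‖) ^ N * Real.exp (-(1 / 8 * ‖x‖ ^ 2)))
  {lam κ δ R : ℝ} {f : EuclideanSpace ℝ (Fin 2) → ℝ}
  (hf : ∀ x, f x = Δ u x + lam * x 0 * fderiv ℝ u x (EuclideanSpace.single 0 1) -
      (κ * ‖x‖ ^ 2 + δ * x 0 ^ 2) * u x + (1 + lam) / 2 * u x -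
      R * ((8 * Real.pi)⁻¹ * burgersPhi (‖x‖ ^ 2 / 4) * fderiv ℝ u x (perp x)))
  (hfc : Continuous f)
  (hfB : ∃ (C : ℝ) (N : ℕ), ∀ x, |f x| ≤ C * (1 + ‖x‖) ^ N * Real.exp (-(1 / 8 * ‖x‖ ^ 2)))

include hu hB in
/-- `∫ u Δu = −∫ |∇u|²`. [folklore] -/
theorem integral_self_mul_laplacian_eq :
    ∫ x, u x * Δ u x = -∫ x, (fderiv ℝ u x (EuclideanSpace.single 0 1) ^ 2 +
      fderiv ℝ u x (EuclideanSpace.single 1 1) ^ 2) := by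
  have h := integral_mul_mul_laplacian_eq_of_gaussDecay hu hB (m := fun _ => (1 : ℝ)) contDiff_const
    (polyBound_const 1) (fun v => ⟨0, 0, fun x => by simp⟩)
  simp only [one_mul, fderiv_fun_const, Pi.zero_apply, zero_apply, zero_mul, add_zero, mul_zero] at h
  exact h

include hu hB in
/-- `∫ xᵢ u ∂ᵢu = −½ ∫ u²`. [folklore] -/
theorem integral_coord_mul_mul_fderiv_eq (i : Fin 2) :
    ∫ x, x i * u x * fderiv ℝ u x (EuclideanSpace.single i 1) = -(1 / 2) * ∫ x, u x ^ 2 := by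
  have h := integral_mul_mul_fderiv_apply_eq_of_gaussDecay hu hB (contDiff_coord i) (polyBound_coord i)
    (EuclideanSpace.single i 1) (polyBound_fderiv_coord i _)
  simp only [fderiv_coord_apply] at h
  rw [h]
  congr 1
  refine integral_congr_ae (Eventually.of_forall fun x => ?_)
  simp

include hu hB in
/-- `∫ Ω u ∂_θu = 0` (`Ω` radial). [folklore] -/
theorem integral_omega_mul_mul_fderiv_perp_eq_zero :
    ∫ x, (8 * Real.pi)⁻¹ * burgersPhi (‖x‖ ^ 2 / 4) * u x * fderiv ℝ u x (perp x) = 0 := by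
  rw [integral_mul_mul_fderiv_perp_eq_of_gaussDecay hu hB contDiff_omega polyBound_omega
    polyBound_fderiv_omega]
  simp only [fderiv_omega_perp, zero_mul, integral_zero, mul_zero]

include hu hB in
/-- `∫ |x|²Ω u ∂_θu = 0` (`|x|²Ω` radial). [folklore] -/
theorem integral_norm_sq_omega_mul_mul_fderiv_perp_eq_zero :
    ∫ x, ‖x‖ ^ 2 * ((8 * Real.pi)⁻¹ * burgersPhi (‖x‖ ^ 2 / 4)) * u x * fderiv ℝ u x (perp x) = 0 := by
  rw [integral_mul_mul_fderiv_perp_eq_of_gaussDecay hu hB ((contDiff_norm_sq ℝ).mul contDiff_omega)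
    (polyBound_of_le_mul polyBound_norm_sq polyBound_omega fun x => (abs_mul _ _).le)
    (fun v => polyBound_fderiv_mul_apply (contDiff_norm_sq ℝ) contDiff_omega polyBound_norm_sq
      polyBound_omega v (polyBound_fderiv_norm_sq v) (polyBound_fderiv_omega v))]
  have h0 : ∀ x : EuclideanSpace ℝ (Fin 2), fderiv ℝ (fun y : EuclideanSpace ℝ (Fin 2) =>
      ‖y‖ ^ 2 * ((8 * Real.pi)⁻¹ * burgersPhi (‖y‖ ^ 2 / 4))) x (perp x) = 0 := by
    intro x
    rw [fderiv_mul_apply_of_contDiff (contDiff_norm_sq ℝ) contDiff_omega, fderiv_omega_perp,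
      fderiv_norm_sq_apply', inner_self_perp]
    ring
  simp only [h0, zero_mul, integral_zero, mul_zero]

include hu hB hf in
/-- **(E) The energy identity**: `∫ (H̃u) u = −∫|∇u|² − ∫ (κ|x|² + δx₀²) u² + ½ ∫ u²`. [folklore] -/
theorem oddAttenuation_energy_identity :
    ∫ x, f x * u x = -(∫ x, (fderiv ℝ u x (EuclideanSpace.single 0 1) ^ 2 +
        fderiv ℝ u x (EuclideanSpace.single 1 1) ^ 2)) -
      (∫ x, (κ * ‖x‖ ^ 2 + δ * x 0 ^ 2) * u x ^ 2) + 1 / 2 * ∫ x, u x ^ 2 := by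
  have hU := gaussDecay_self hB
  have e1 : ∀ x, f x * u x = u x * Δ u x + lam * (x 0 * u x * fderiv ℝ u x (EuclideanSpace.single 0 1)) -
      (κ * ‖x‖ ^ 2 + δ * x 0 ^ 2) * u x ^ 2 + (1 + lam) / 2 * u x ^ 2 -
      R * ((8 * Real.pi)⁻¹ * burgersPhi (‖x‖ ^ 2 / 4) * u x * fderiv ℝ u x (perp x)) := by
    intro x; rw [hf]; ring
  have hlap : ∀ x, Δ u x = fderiv ℝ (fderiv ℝ u) x (EuclideanSpace.single 0 1) (EuclideanSpace.single 0 1) +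
      fderiv ℝ (fderiv ℝ u) x (EuclideanSpace.single 1 1) (EuclideanSpace.single 1 1) := fun x => by
    rw [laplacian_eq_sum_fderiv_fderiv (EuclideanSpace.basisFun (Fin 2) ℝ) hu x, Fin.sum_univ_two,
      EuclideanSpace.basisFun_apply, EuclideanSpace.basisFun_apply, fderiv_partialDeriv_apply hu,
      fderiv_partialDeriv_apply hu]
  have iA : Integrable fun x => u x * Δ u x := by
    have e : (fun x => u x * Δ u x) = fun x =>
        u x * fderiv ℝ (fderiv ℝ u) x (EuclideanSpace.single 0 1) (EuclideanSpace.single 0 1) +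
        u x * fderiv ℝ (fderiv ℝ u) x (EuclideanSpace.single 1 1) (EuclideanSpace.single 1 1) := by
      funext x; rw [hlap]; ring
    rw [e]
    refine Integrable.add ?_ ?_ <;>
      exact integrable_of_gaussDecay (by norm_num)
        (hu.continuous.mul (continuous_fderiv_fderiv_apply_of_contDiff_two hu _ _))
        (gaussDecay_of_le_poly_mul_mul (polyBound_const 1) hU (gaussDecay_fderiv_fderiv_apply hB _ _)
          fun x => by rw [abs_mul, abs_one, one_mul])
  have iB : Integrable fun x => x 0 * u x * fderiv ℝ u x (EuclideanSpace.single 0 1) :=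
    integrable_of_gaussDecay (by norm_num)
      (((contDiff_coord 0 (n := 0)).continuous.mul hu.continuous).mul (continuous_fderiv_apply_of_contDiff_two hu _))
      (gaussDecay_of_le_poly_mul_mul (polyBound_coord 0) hU (gaussDecay_fderiv_apply hB _)
        fun x => by rw [abs_mul, abs_mul])
  have hVc : Continuous fun x : EuclideanSpace ℝ (Fin 2) => κ * ‖x‖ ^ 2 + δ * x 0 ^ 2 :=
    (continuous_const.mul (continuous_norm.pow 2)).add (continuous_const.mul ((contDiff_coord 0 (n := 0)).continuous.pow 2))
  have hVp : ∃ (C : ℝ) (N : ℕ), ∀ x : EuclideanSpace ℝ (Fin 2), |κ * ‖x‖ ^ 2 + δ * x 0 ^ 2| ≤ C * (1 + ‖x‖) ^ N :=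
    polyBound_of_le_add
      (polyBound_of_le_mul (polyBound_const κ) polyBound_norm_sq (H := fun x => κ * ‖x‖ ^ 2)
        fun x => (abs_mul _ _).le)
      (polyBound_of_le_mul (polyBound_const δ) (polyBound_of_le_mul (polyBound_coord 0) (polyBound_coord 0)
        (H := fun x => x 0 ^ 2) fun x => by rw [sq, abs_mul]) (H := fun x => δ * x 0 ^ 2)
        fun x => (abs_mul _ _).le)
      fun x => abs_add_le _ _
  have iC : Integrable fun x => (κ * ‖x‖ ^ 2 + δ * x 0 ^ 2) * u x ^ 2 :=
    integrable_of_gaussDecay (by norm_num) (hVc.mul (hu.continuous.pow 2))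
      (gaussDecay_of_le_poly_mul_mul hVp hU hU fun x => abs_mul_sq_le _ _)
  have iD : Integrable fun x => u x ^ 2 :=
    integrable_of_gaussDecay (by norm_num) (hu.continuous.pow 2)
      (gaussDecay_of_le_poly_mul_mul (polyBound_const 1) hU hU fun x => abs_sq_le_one_mul _)
  have iE : Integrable fun x => (8 * Real.pi)⁻¹ * burgersPhi (‖x‖ ^ 2 / 4) * u x * fderiv ℝ u x (perp x) :=
    integrable_of_gaussDecay (by norm_num)
      (((contDiff_omega (n := 0)).continuous.mul hu.continuous).mul (continuous_fderiv_perp_of_contDiff_two hu))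
      (gaussDecay_of_le_poly_mul_mul polyBound_omega hU (gaussDecay_fderiv_perp hB)
        fun x => by rw [abs_mul, abs_mul])
  have iB' : Integrable fun x => lam * (x 0 * u x * fderiv ℝ u x (EuclideanSpace.single 0 1)) :=
    iB.const_mul lam
  have iD' : Integrable fun x => (1 + lam) / 2 * u x ^ 2 := iD.const_mul _
  have iE' : Integrable fun x =>
      R * ((8 * Real.pi)⁻¹ * burgersPhi (‖x‖ ^ 2 / 4) * u x * fderiv ℝ u x (perp x)) := iE.const_mul R
  have i2 : Integrable fun x => u x * Δ u x + lam * (x 0 * u x * fderiv ℝ u x (EuclideanSpace.single 0 1)) :=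
    iA.add iB'
  have i3 : Integrable fun x => u x * Δ u x + lam * (x 0 * u x * fderiv ℝ u x (EuclideanSpace.single 0 1)) -
      (κ * ‖x‖ ^ 2 + δ * x 0 ^ 2) * u x ^ 2 := i2.sub iC
  have i4 : Integrable fun x => u x * Δ u x + lam * (x 0 * u x * fderiv ℝ u x (EuclideanSpace.single 0 1)) -
      (κ * ‖x‖ ^ 2 + δ * x 0 ^ 2) * u x ^ 2 + (1 + lam) / 2 * u x ^ 2 := i3.add iD'
  simp_rw [e1]
  rw [integral_sub i4 iE', integral_add i3 iD', integral_sub i2 iC, integral_add iA iB',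
    integral_const_mul, integral_const_mul, integral_const_mul,
    integral_self_mul_laplacian_eq hu hB, integral_coord_mul_mul_fderiv_eq hu hB 0,
    integral_omega_mul_mul_fderiv_perp_eq_zero hu hB]
  ring

include hu hB hf hfc hfB in
/-- **(E′) The energy estimate**: `κ ∫|x|²u² ≤ (∫(H̃u)²)^{1/2} (∫u²)^{1/2} + ½ ∫u²` (`δ ≥ 0`; drop
`∫|∇u|² ≥ 0`, Cauchy–Schwarz). [folklore] -/
theorem oddAttenuation_energy_estimate (hδ : 0 ≤ δ) :
    κ * ∫ x, ‖x‖ ^ 2 * u x ^ 2 ≤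
      Real.sqrt (∫ x, f x ^ 2) * Real.sqrt (∫ x, u x ^ 2) + 1 / 2 * ∫ x, u x ^ 2 := by
  have hid := oddAttenuation_energy_identity hu hB hf
  have hU := gaussDecay_self hB
  have iu2 : Integrable fun x => u x ^ 2 :=
    integrable_of_gaussDecay (by norm_num) (hu.continuous.pow 2)
      (gaussDecay_of_le_poly_mul_mul (polyBound_const 1) hU hU fun x => abs_sq_le_one_mul _)
  have if2 : Integrable fun x => f x ^ 2 :=
    integrable_of_gaussDecay (by norm_num) (hfc.pow 2)
      (gaussDecay_of_le_poly_mul_mul (polyBound_const 1) hfB hfB fun x => abs_sq_le_one_mul _)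
  have ifu : Integrable fun x => f x * u x :=
    integrable_of_gaussDecay (by norm_num) (hfc.mul hu.continuous)
      (gaussDecay_of_le_poly_mul_mul (polyBound_const 1) hfB hU fun x => by rw [abs_mul, abs_one, one_mul])
  have iX : Integrable fun x => ‖x‖ ^ 2 * u x ^ 2 :=
    integrable_of_gaussDecay (by norm_num) ((continuous_norm.pow 2).mul (hu.continuous.pow 2))
      (gaussDecay_of_le_poly_mul_mul polyBound_norm_sq hU hU fun x => abs_mul_sq_le _ _)
  have hVp : ∃ (C : ℝ) (N : ℕ), ∀ x : EuclideanSpace ℝ (Fin 2), |κ * ‖x‖ ^ 2 + δ * x 0 ^ 2| ≤ C * (1 + ‖x‖) ^ N :=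
    polyBound_of_le_add
      (polyBound_of_le_mul (polyBound_const κ) polyBound_norm_sq (H := fun x => κ * ‖x‖ ^ 2)
        fun x => (abs_mul _ _).le)
      (polyBound_of_le_mul (polyBound_const δ) (polyBound_of_le_mul (polyBound_coord 0) (polyBound_coord 0)
        (H := fun x => x 0 ^ 2) fun x => by rw [sq, abs_mul]) (H := fun x => δ * x 0 ^ 2)
        fun x => (abs_mul _ _).le)
      fun x => abs_add_le _ _
  have iV : Integrable fun x => (κ * ‖x‖ ^ 2 + δ * x 0 ^ 2) * u x ^ 2 :=
    integrable_of_gaussDecay (by norm_num)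
      (((continuous_const.mul (continuous_norm.pow 2)).add
        (continuous_const.mul ((contDiff_coord 0 (n := 0)).continuous.pow 2))).mul (hu.continuous.pow 2))
      (gaussDecay_of_le_poly_mul_mul hVp hU hU fun x => abs_mul_sq_le _ _)
  have hK : 0 ≤ ∫ x, (fderiv ℝ u x (EuclideanSpace.single 0 1) ^ 2 +
      fderiv ℝ u x (EuclideanSpace.single 1 1) ^ 2) := integral_nonneg fun x => by positivity
  have hCS := abs_integral_mul_le_sqrt_mul_sqrt if2 iu2 ifu
  have hVX : κ * ∫ x, ‖x‖ ^ 2 * u x ^ 2 ≤ ∫ x, (κ * ‖x‖ ^ 2 + δ * x 0 ^ 2) * u x ^ 2 := by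
    rw [← integral_const_mul]
    refine integral_mono (iX.const_mul κ) iV fun x => ?_
    dsimp only
    nlinarith [mul_nonneg (mul_nonneg hδ (sq_nonneg (x 0))) (sq_nonneg (u x))]
  have hfu : -(∫ x, f x * u x) ≤ Real.sqrt (∫ x, f x ^ 2) * Real.sqrt (∫ x, u x ^ 2) :=
    (neg_le_abs _).trans hCS
  linarith

end Energy

/-- Registered tools stub of crux stmt-NavierStokesRegularity-17973 (`stub_oddAttenuationToolsD`):
the energy identity and the energy estimate of the conjugated local operator
`H̃u = Δu + λx₀∂₀u − (κ|x|² + δx₀²)u + ((1+λ)/2)u − RΩ∂_θu` in the Gaussian decay class. [folklore] -/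
theorem stub_oddAttenuationToolsD :
    ∀ (u : EuclideanSpace ℝ (Fin 2) → ℝ), ContDiff ℝ 2 u →
      (∃ (C : ℝ) (N : ℕ), ∀ x, |u x| ≤ C * (1 + ‖x‖) ^ N * Real.exp (-(1 / 8 * ‖x‖ ^ 2)) ∧
        ‖fderiv ℝ u x‖ ≤ C * (1 + ‖x‖) ^ N * Real.exp (-(1 / 8 * ‖x‖ ^ 2)) ∧
        ‖fderiv ℝ (fderiv ℝ u) x‖ ≤ C * (1 + ‖x‖) ^ N * Real.exp (-(1 / 8 * ‖x‖ ^ 2))) →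
      ∀ (lam κ δ R : ℝ) (f : EuclideanSpace ℝ (Fin 2) → ℝ),
      (∀ x, f x = Δ u x + lam * x 0 * fderiv ℝ u x (EuclideanSpace.single 0 1) -
        (κ * ‖x‖ ^ 2 + δ * x 0 ^ 2) * u x + (1 + lam) / 2 * u x -
        R * ((8 * Real.pi)⁻¹ * burgersPhi (‖x‖ ^ 2 / 4) * fderiv ℝ u x (perp x))) →
      (∫ x, f x * u x = -(∫ x, (fderiv ℝ u x (EuclideanSpace.single 0 1) ^ 2 +
          fderiv ℝ u x (EuclideanSpace.single 1 1) ^ 2)) -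
        (∫ x, (κ * ‖x‖ ^ 2 + δ * x 0 ^ 2) * u x ^ 2) + 1 / 2 * ∫ x, u x ^ 2) ∧
      (Continuous f →
        (∃ (C : ℝ) (N : ℕ), ∀ x, |f x| ≤ C * (1 + ‖x‖) ^ N * Real.exp (-(1 / 8 * ‖x‖ ^ 2))) →
        0 ≤ δ →
        κ * ∫ x, ‖x‖ ^ 2 * u x ^ 2 ≤
          Real.sqrt (∫ x, f x ^ 2) * Real.sqrt (∫ x, u x ^ 2) + 1 / 2 * ∫ x, u x ^ 2) :=
  fun _ hu hB _ _ _ _ _ hf =>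
    ⟨oddAttenuation_energy_identity hu hB hf,
      fun hfc hfB hδ => oddAttenuation_energy_estimate hu hB hf hfc hfB hδ⟩

end Summit.NavierStokesRegularity.NavierStokesRegularity.Theorems
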